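import Mathlib
import Summits.Ventures.PercRepro2.RootLeafUCoin3AlgL

/-!
# (G4-u), the 3-coin class `N(b) = {a₂, u, c}` — the algebraic core, L side (2/2): the exploration identity for (MIX-L) (blind cell PercRepro2, p4 g17; S3 (G4-u) item (ad), proofs/P4-G17-COIN3.md)

`b` is adjacent exactly to the root `a₂` (coin `a = p₁`), the root `u` (coin `s = p₂`) and the mark
`c` (coin `k = p₃`).  Every mass of the instance `(o, u, a₂, c, b)` is a coin polynomial in the
masses of the OUTSIDE instance `G₀ = G − b` (marks `o, u, a₂, c`; the pinned weights
`p[f₁, f₂, f₃ ↦ 0]`): the MASS TABLE, taken here as hypotheses (`hZ, hD, …`) and proved from the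
graph in RootLeafUCoin3Table.  With `A_c = w000 + w100 + w010 + w001` the c-neutral coin mass,
`ρ₃ = (1 − s)(a − k)`, `κ_B = (1 − a)s(1 − k) + (1 − s)(1 − ak)`, and the outside quantities
`D₀, t₀, t′₀` (the `Q₀`-split by the location of `c`), `d₀₀ = P(c ∉ K₀)`, `d_cu = P(c ∉ K₀ ∪ L₀)
= d₀₀ − t′₀`, `ℋ′₀ = t′₀·PD₀oK − D₀·T′₀oK ≥ 0` and `δ_o₀ = t₀·PD₀oL − D₀·T₀oL ≥ 0` (BHK06 1.4 on
`G₀`):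

* **`MK_nonneg`**: `M_K := A·A_c − 2β·ρ₃ ≥ 0` — every tensor-Bernstein coefficient of `M_K` in
  `(a, s, k)` is a nonnegative combination of products of `D₀, t₀, t′₀, σ = d₀₀ − D₀ − t′₀,
  h = 1 − Z₀, μ = h − σ` and the Harris slack `Hs = D₀ − d_cu·Z₀` (exact LP certificate, 228 terms).
* **`mixK_of_table`**: `A·ℋ′ + 2β·X_b = (1 − a + a(1 − s)(1 − k))·ℋ′₀·M_K` (the `P(· | u, c ∉ K)`
  exploration: the conditional expectation of the (MIX-K) functional given `K₀` is affine in
  `γ(K₀) = P(c ↔ u in G₀ − K₀)`), hence (MIX-K) `0 ≤ A·ℋ′ + 2β·X_b` — the hypothesis of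
  `MixK.T2oK_nonneg_of_mixK`.
* **`ML_nonneg`**: `M_L := (OU) − t₀·(B·κ_B + 2β(1 − a)(s − k)) ≥ 0` (388-term certificate over the
  same atoms).
* **`mixL_of_table`**: `W·T2oL = τ·[(OU)·Y₀ − (B·κ_B + 2β(1 − a)(s − k))·δ_o₀]` with
  `τ = (1 − a)s(1 − k) + (1 − s)`, and `δ_o₀ ≤ t₀·Y₀`, so the right-hand side of the mirror identity
  of RootLeafUMixL is `≥ 0` — the hypothesis of `MixL.T2oL_nonneg_of_mixL`.

No definitions; every mass is a variable and the table is a hypothesis list.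
-/

namespace Summit.Ventures.PercRepro2

namespace RootLeafU

namespace Coin3

variable {R : Type*} [Field R] [LinearOrder R] [IsStrictOrderedRing R]

set_option maxHeartbeats 4000000 in
/-- **The L-side exploration identity and (MIX-L) on the 3-coin class**:
the right-hand side of the mirror identity `W·T2oL = B(Y_tW − tY) + 2β[…] + (OU)·Y` equals
`τ·[(OU)·Y₀ − c′·δ_o₀]` with `τ = (1 − a)s(1 − k) + (1 − s)`, `c′ = B·κ_B + 2β(1 − a)(s − k)`, and
is `≥ 0`: if `c′ ≤ 0` both terms are, and if `c′ > 0` then `c′·δ_o₀ ≤ c′·t₀·Y₀ ≤ (OU)·Y₀` by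
`ML_nonneg`.  The conclusion is the hypothesis `hmix` of `MixL.T2oL_nonneg_of_mixL` with `S = 1`
(and `(OU)` written out, `(OU) = T2oL(o := u)`). -/
theorem mixL_of_table (a s k Z D t tp hb d0 gap TpbL TbK TbL TpbK PDbL PDbK PDoL ToL ToLbL PDoLbK ToLbK OU D0 t0 tp0 d00 dcu PD0oL T0oL : R) (ha0 : 0 ≤ a) (ha1 : a ≤ 1) (hs0 : 0 ≤ s) (hs1 : s ≤ 1) (hk0 : 0 ≤ k) (hk1 : k ≤ 1)
    (hD0 : 0 ≤ D0) (ht0 : 0 ≤ t0) (htp0 : 0 ≤ tp0) (hsig : D0 + tp0 ≤ d00) (hh : D0 + t0 + tp0 ≤ 1)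
    (hmu : d00 + t0 ≤ 1) (hHs : dcu * (D0 + t0 + tp0) ≤ D0) (hdcu : dcu = d00 - tp0) (hdlt : 0 ≤ t0 * PD0oL - D0 * T0oL) (hPD0oL : 0 ≤ PD0oL) (hT0oL : 0 ≤ T0oL)
    (hOU0 : 0 ≤ OU) (hOU : OU = (((D * hb + d0 * gap) + (1 * (TpbL + TbK - TbL - TpbK) + 1 * (PDbL + PDbK) + hb * (tp - t) + hb * Z - (1 - d0) * gap)) * D + 2 * (D * hb + d0 * gap) * t + 2 * (1 * D + d0 * Z) * TbL - 2 * (1 * D + d0 * Z) * (PDbK + TbK)))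
    (hZ : Z = ((((1 - a) * (1 - s) * (1 - k)) + (a * (1 - s) * (1 - k)) + ((1 - a) * s * (1 - k)) + ((1 - a) * (1 - s) * k)) * (D0 + t0 + tp0) + (a * (1 - s) * k) * (D0 + t0) + ((1 - a) * s * k) * (D0 + tp0))) (hD : D = ((((1 - a) * (1 - s) * (1 - k)) + (a * (1 - s) * (1 - k)) + ((1 - a) * s * (1 - k)) + ((1 - a) * (1 - s) * k)) * D0)) (ht : t = ((((1 - a) * (1 - s) * (1 - k)) + (a * (1 - s) * (1 - k)) + ((1 - a) * s * (1 - k)) + ((1 - a) * (1 - s) * k)) * t0 + (a * (1 - s) * k) * (D0 + t0))) (htp : tp = ((((1 - a) * (1 - s) * (1 - k)) + (a * (1 - s) * (1 - k)) + ((1 - a) * s * (1 - k)) + ((1 - a) * (1 - s) * k)) * tp0 + ((1 - a) * s * k) * (D0 + tp0))) (hhb : hb = (a + (1 - a) * (s * (1 - k) * (1 - (D0 + t0 + tp0)) + (1 - s) * k * (1 - d00) + s * k * (1 - (D0 + tp0))))) (hd0 : d0 = ((((1 - a) * (1 - s) * (1 - k)) + (a * (1 - s) * (1 - k)) + ((1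 - a) * s * (1 - k)) + ((1 - a) * (1 - s) * k)) * d00 + (a * s * (1 - k)) * dcu + ((1 - a) * s * k) * (D0 + tp0))) (hgap : gap = (PDbK + TbK + TpbK) - (PDbL + TbL + TpbL)) (hTpbL : TpbL = ((((1 - a) * s * (1 - k)) + ((1 - a) * (1 - s) * k)) * tp0 + ((1 - a) * s * k) * (D0 + tp0))) (hTbK : TbK = (((a * (1 - s) * (1 - k)) + ((1 - a) * (1 - s) * k)) * t0 + (a * (1 - s) * k) * (D0 + t0))) (hTbL : TbL = (((1 - a) * s * (1 - k)) * t0)) (hTpbK : TpbK = ((a * (1 - s) * (1 - k)) * tp0)) (hPDbL : PDbL = (((1 - a) * s * (1 - k)) * D0)) (hPDbK : PDbK = ((a * (1 - s) * (1 - k)) * D0)) (hPDoL : PDoL = ((((1 - a) * (1 - s) * (1 - k)) + (a * (1 - s) * (1 - k)) + ((1 - a) * s * (1 - k)) + ((1 - a) * (1 - s) * k)) * PD0oL)) (hToL : ToL = ((((1 - a) * (1 - s) * (1 - k)) + (a * (1 - s) * (1 - k)) + ((1 - a) * s * (1 - k)) + ((1 - a) * (1 - s) * k)) * T0oL + (a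 * (1 - s) * k) * (PD0oL + T0oL))) (hToLbL : ToLbL = (((1 - a) * s * (1 - k)) * T0oL)) (hPDoLbK : PDoLbK = ((a * (1 - s) * (1 - k)) * PD0oL)) (hToLbK : ToLbK = (((a * (1 - s) * (1 - k)) + ((1 - a) * (1 - s) * k)) * T0oL + (a * (1 - s) * k) * (PD0oL + T0oL))) :
    0 ≤ ((D * hb + d0 * gap) - (1 * (TpbL + TbK - TbL - TpbK) + 1 * (PDbL + PDbK) + hb * (tp - t) + hb * Z - (1 - d0) * gap)) * (ToL * (D + t) - t * (PDoL + ToL)) + 2 * (1 * D + d0 * Z) * ((ToLbL * (D + t) - TbL * (PDoL + ToL)) - ((PDoLbK + ToLbK) * (D + t) - (PDbK + TbK) * (PDoL + ToL))) + OU * (PDoL + ToL) := by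
  have hML := ML_nonneg a s k Z D t tp hb d0 gap TpbL TbK TbL TpbK PDbL PDbK D0 t0 tp0 d00 dcu
    (d00 - D0 - tp0) (1 - D0 - t0 - tp0)
    (1 - D0 - t0 - tp0 - (d00 - D0 - tp0)) (D0 * (1 - D0 - t0 - tp0) - (d00 - D0 - tp0) * (1 - (1 - D0 - t0 - tp0)))
    ha0 ha1 hs0 hs1 hk0 hk1 hD0 ht0 htp0 (by linarith) (by linarith) (by linarith)
    (by rw [hdcu] at hHs; nlinarith [hHs]) (by ring) hdcu rfl rfl rfl
    hZ hD ht htp hhb hd0 hgap hTpbL hTbK hTbL hTpbK hPDbL hPDbK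
  have key : ((D * hb + d0 * gap) - (1 * (TpbL + TbK - TbL - TpbK) + 1 * (PDbL + PDbK) + hb * (tp - t) + hb * Z - (1 - d0) * gap)) * (ToL * (D + t) - t * (PDoL + ToL)) + 2 * (1 * D + d0 * Z) * ((ToLbL * (D + t) - TbL * (PDoL + ToL)) - ((PDoLbK + ToLbK) * (D + t) - (PDbK + TbK) * (PDoL + ToL))) + OU * (PDoL + ToL) = ((1 - a) * s * (1 - k) + (1 - s)) * (OU * (PD0oL + T0oL) - (((D * hb + d0 * gap) - (1 * (TpbL + TbK - TbL - TpbK) + 1 * (PDbL + PDbK) + hb * (tp - t) + hb * Z - (1 - d0) * gap)) * ((1 - a) * s * (1 - k) + (1 - s) * (1 - a * k)) + 2 * (1 * D + d0 * Z) * (1 - a) * (s - k)) * (t0 * PD0oL - D0 * T0oL)) := by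
    subst hZ hD ht htp hhb hd0 hgap hTpbL hTbK hTbL hTpbK hPDbL hPDbK hPDoL hToL hToLbL hPDoLbK hToLbK
    ring
  rw [key]
  have hMLt : t0 * (((D * hb + d0 * gap) - (1 * (TpbL + TbK - TbL - TpbK) + 1 * (PDbL + PDbK) + hb * (tp - t) + hb * Z - (1 - d0) * gap)) * ((1 - a) * s * (1 - k) + (1 - s) * (1 - a * k)) + 2 * (1 * D + d0 * Z) * (1 - a) * (s - k)) ≤ OU := by
    rw [hOU]
    exact sub_nonneg.mp hML
  clear hML key
  have h1a : 0 ≤ 1 - a := by linarith only [ha1]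
  have h1s : 0 ≤ 1 - s := by linarith only [hs1]
  have h1k : 0 ≤ 1 - k := by linarith only [hk1]
  have hτ : 0 ≤ ((1 - a) * s * (1 - k) + (1 - s)) := by positivity
  refine mul_nonneg hτ ?_
  have hY0 : 0 ≤ (PD0oL + T0oL) := by positivity
  have hdltY : (t0 * PD0oL - D0 * T0oL) ≤ t0 * (PD0oL + T0oL) := by
    have e1 := mul_nonneg hD0 hT0oL
    have e2 := mul_nonneg ht0 hT0oL
    linarith only [e1, e2]
  set cp := (((D * hb + d0 * gap) - (1 * (TpbL + TbK - TbL - TpbK) + 1 * (PDbL + PDbK) + hb * (tp - t) + hb * Z - (1 - d0) * gap)) * ((1 - a) * s * (1 - k) + (1 - s) * (1 - a * k)) + 2 * (1 * D + d0 * Z) * (1 - a) * (s - k)) with hcp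
  clear_value cp
  rcases le_or_gt cp 0 with hc | hc
  · have e1 := mul_nonneg hOU0 hY0
    have e2 := mul_nonneg (neg_nonneg.mpr hc) hdlt
    linarith only [e1, e2]
  · have e1 := mul_le_mul_of_nonneg_left hdltY hc.le
    have e2 := mul_le_mul_of_nonneg_right hMLt hY0
    linarith only [e1, e2]

end Coin3

end RootLeafU

end Summit.Ventures.PercRepro2
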